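import Summits.AtomisticToContinuum.Crystallization.Theorems.FrustratedLawDichotomyStrainedPatchHomCurvLeafHC
import Summits.AtomisticToContinuum.Crystallization.Theorems.FrustratedLawDichotomyStrainedPatchHomSlopeLeafC

/-!
# The ξ-CONVEXITY VERDICT WITH THE CENTRED SLOPE LEAF: `entryLeafOKHCC` (value ⊕ `slopeCheckC` ⊕ centred curvature ⟹ the hver energy disjunct)

decomp-a2c hand-1 g28 (crux `AperiodicFrustratedLawGap`, stmt-AtomisticToContinuum-27623; `(H) HomFloor (1/625)`, hcp half; lever (C), critic row
1083 (B)).  Verbatim `…HomCurvLeafHC.entryLeafOKHC` with ONE swap: the naive `ℓ¹` slope constant `slopeGs` (measured `3.28·SC` at the hcp⋆ `2⁻⁹` box —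
`G²/(2λ)` swamps every margin) is replaced by the centred `ℓ²` constant `slopeGsC` of `…HomSlopeLeafC` (`0.071·SC` on the same box), computed on the
reference box `(c, refW w)` over the split `slLc c w ++ slLn c w` (labels whose reference tube lies in the bump / Lennard-Jones regime are centred, the rest
naive) of the SAME near-label set `cenL c w ++ naiL c w`.

* §1 `hcpEnergy_of_xiElimC` — the ξ-elimination glue of `…HomXiElimL.hcpEnergy_of_xiElimL2` with `slopeCheckC` on an arbitrary re-split of the label set;
* §2 the verdict `entryLeafOKHCC μ` and ★★★ `entryLeafOKHCC_sound` (hver energy disjunct, same proof skeleton as `entryLeafOKHC_sound`);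
* §3 `entryLeafOKHCCX μ := entryLeafOKHCC μ ∨ entryLeafOKHX μ`, its soundness and `hcpHalf_of_entryTreeHCCX`.

Kernel definitions + soundness; 0 sorry; standard axioms; no instances / notation / `#eval`.  `--supports stmt-AtomisticToContinuum-27623`.
-/

noncomputable section

namespace Summit.AtomisticToContinuum.Crystallization.Theorems.FrustratedLawDichotomyStrainedPatchHomCurvLeafHCC

open scoped BigOperators RealInnerProductSpace
open Literature.Analysis.ValidatedNumerics.Numerics
open Summit.AtomisticToContinuum.Crystallization.Theorems.ChargedEnergyGapNegative (E3)
open Summit.AtomisticToContinuum.Crystallization.Theorems.FrustratedLawDichotomySchurCut (effPot w₄₅ ω₄)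
open Summit.AtomisticToContinuum.Crystallization.Theorems.FrustratedLawDichotomyAveragingRuleTightFree (TightNearCap BadNearCap)
open Summit.AtomisticToContinuum.Crystallization.Theorems.FrustratedLawDichotomyExemptAbsorption (ExemptNear)
open Summit.AtomisticToContinuum.Crystallization.Theorems.FrustratedLawDichotomyStrainedPatchHomSplit
open Summit.AtomisticToContinuum.Crystallization.Theorems.FrustratedLawDichotomyStrainedPatchHomEntryGramHcp (rootCH rootWH)
open Summit.AtomisticToContinuum.Crystallization.Theorems.FrustratedLawDichotomyStrainedPatchHomConvexSegment (hcpShifted_floor_W45)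
open Summit.AtomisticToContinuum.Crystallization.Theorems.FrustratedLawDichotomyStrainedPatchEnvelopeTaylor (Wrec)
open Summit.AtomisticToContinuum.Crystallization.Theorems.FrustratedLawDichotomyStrainedPatchHomCurvLeaf
  (nearLabels nearLabels_nodup nodup_filter_append boxSum_eq_nearSum toFinset_filter_append)
open Summit.AtomisticToContinuum.Crystallization.Theorems.FrustratedLawDichotomyStrainedPatchHomCurvLeafL (naiveK)
open Summit.AtomisticToContinuum.Crystallization.Theorems.FrustratedLawDichotomyStrainedPatchHomCurvLeafL2
open Summit.AtomisticToContinuum.Crystallization.Theorems.FrustratedLawDichotomyStrainedPatchHomCurvCentreKit (cenShuf cenShuf_apply)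
open Summit.AtomisticToContinuum.Crystallization.Theorems.FrustratedLawDichotomyStrainedPatchHomForceHcp
  (xiBallOK norm_le_quarter_of_xiBallOK entryLeafOKHX entryLeafOKHX_sound)
open Summit.AtomisticToContinuum.Crystallization.Theorems.FrustratedLawDichotomyStrainedPatchHomLeafTableCheckHcpV (tableLeafOKHV leafCheckV_sound_hcp lvOf_mem)
open Summit.AtomisticToContinuum.Crystallization.Theorems.FrustratedLawDichotomyStrainedPatchHomEntryTableHcp (abs_le_of_shufInOK sgnZ_two_natAbs)
open Summit.AtomisticToContinuum.Crystallization.Theorems.FrustratedLawDichotomyStrainedPatchHomLeafTableCheckHcp (tabSem_of_allOKK)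
open Summit.AtomisticToContinuum.Crystallization.Theorems.FrustratedLawDichotomyStrainedPatchHomLeafTableCheck (qTableK1 qTableK1_allOKK tabE)
open Summit.AtomisticToContinuum.Crystallization.Theorems.FrustratedLawDichotomyStrainedPatchHomCertTree (CertTree treeOK)
open Summit.AtomisticToContinuum.Crystallization.Theorems.FrustratedLawDichotomyStrainedPatchHomEntryFlipHcp (HcpDich hcpHalf_of_entryTreeShuf)
open Summit.AtomisticToContinuum.Crystallization.Theorems.FrustratedLawDichotomyStrainedPatchHomSlopeCentre (slopeLabelOK)
open Summit.AtomisticToContinuum.Crystallization.Theorems.FrustratedLawDichotomyStrainedPatchHomSlopeLeafC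
  (slopeCheckC slopeGsC slopeCheckC_slopeGsC slope_bound_of_slopeCheckC)

/-! ## §1. ξ-elimination with the centred slope leaf -/

/-- ★★ **ξ-ELIMINATION WITH `slopeCheckC`**: `…HomXiElimL.hcpEnergy_of_xiElimL2` with the slope certificate `slopeCheckC c₀ w₀ Lcs Lns Gs` on any
duplicate-free re-split `Lcs ++ Lns` of the label set `Lc ++ Ln` (same finset). [folklore chaining: `hcpShifted_floor_W45`] -/
theorem hcpEnergy_of_xiElimC {c₀ w₀ c w : (Fin 3 × Fin 3) ⊕ Fin 3 → ℤ}
    (hsame : ∀ ab : Fin 3 × Fin 3, c₀ (Sum.inl ab) = c (Sum.inl ab) ∧ w₀ (Sum.inl ab) = w (Sum.inl ab))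
    (hsub : ∀ (i : Fin 3) (x : ℝ), |x - (c₀ (Sum.inr i) : ℝ) / SC| ≤ (w₀ (Sum.inr i) : ℝ) / SC → |x - (c (Sum.inr i) : ℝ) / SC| ≤ (w (Sum.inr i) : ℝ) / SC)
    {Lc Ln Lcs Lns : List (Fin 3 → ℤ)} (hL : (Lc ++ Ln).Nodup) (hLs : (Lcs ++ Lns).Nodup) (hfin : (Lcs ++ Lns).toFinset = (Lc ++ Ln).toFinset)
    {Gs lamS : ℤ} (hlam : 0 < lamS)
    (hslope : slopeCheckC c₀ w₀ Lcs Lns Gs = true) (hcurv : curvCheckL2 c w Lc Ln lamS = true)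
    (SA : (E3 →L[ℝ] E3) → ℝ) {V₀ : ℝ}
    (hval : ∀ (U : E3 →L[ℝ] E3) (ξ₀ : E3), ‖U - 1‖ ≤ 1 / 4 →
      (∀ ab : Fin 3 × Fin 3, |(U (EuclideanSpace.single ab.2 (1 : ℝ))) ab.1 - (c₀ (Sum.inl ab) : ℝ) / SC| ≤ (w₀ (Sum.inl ab) : ℝ) / SC) →
      (∀ i : Fin 3, |ξ₀ i - (c₀ (Sum.inr i) : ℝ) / SC| ≤ (w₀ (Sum.inr i) : ℝ) / SC) → ‖ξ₀‖ ≤ 1 / 4 →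
      V₀ ≤ SA U + ∑ b ∈ (Lc ++ Ln).toFinset, effPot w₄₅ ω₄ (3 / 400) ‖latPt U hexFrame b + U (hcpShift + ξ₀)‖)
    (U : E3 →L[ℝ] E3) (hU : ‖U - 1‖ ≤ 1 / 4)
    (hbox : ∀ ab : Fin 3 × Fin 3, |(U (EuclideanSpace.single ab.2 (1 : ℝ))) ab.1 - (c (Sum.inl ab) : ℝ) / SC| ≤ (w (Sum.inl ab) : ℝ) / SC)
    (ξ₀ : E3) (hξ₀ : ∀ i : Fin 3, |ξ₀ i - (c₀ (Sum.inr i) : ℝ) / SC| ≤ (w₀ (Sum.inr i) : ℝ) / SC) (hn₀ : ‖ξ₀‖ ≤ 1 / 4)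
    (ξ : E3) (hξ : ∀ i : Fin 3, |ξ i - (c (Sum.inr i) : ℝ) / SC| ≤ (w (Sum.inr i) : ℝ) / SC) (hn : ‖ξ‖ ≤ 1 / 4) :
    V₀ - ((Gs : ℝ) / SC) ^ 2 / (2 * ((lamS : ℝ) / SC)) ≤
      SA U + ∑ b ∈ (Lc ++ Ln).toFinset, effPot w₄₅ ω₄ (3 / 400) ‖latPt U hexFrame b + U (hcpShift + ξ)‖ := by
  have hS : (0 : ℝ) < SC := by norm_num [SC]
  have hlam' : (0 : ℝ) < (lamS : ℝ) / SC := div_pos (by exact_mod_cast hlam) hS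
  have hbox₀ : ∀ ab : Fin 3 × Fin 3, |(U (EuclideanSpace.single ab.2 (1 : ℝ))) ab.1 - (c₀ (Sum.inl ab) : ℝ) / SC| ≤ (w₀ (Sum.inl ab) : ℝ) / SC := by
    intro ab; rw [(hsame ab).1, (hsame ab).2]; exact hbox ab
  have hξ₀' : ∀ i : Fin 3, |ξ₀ i - (c (Sum.inr i) : ℝ) / SC| ≤ (w (Sum.inr i) : ℝ) / SC := fun i => hsub i _ (hξ₀ i)
  have hV := hval U ξ₀ hU hbox₀ hξ₀ hn₀
  have hG := slope_bound_of_slopeCheckC hLs hslope U hU hbox₀ ξ₀ hξ₀ hn₀ ξ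
  rw [hfin] at hG
  have hV' : V₀ - SA U ≤ ∑ b ∈ (Lc ++ Ln).toFinset, Wrec ‖latPt U hexFrame b + U (hcpShift + ξ₀)‖ := by
    unfold Wrec; linarith
  have key := hcpShifted_floor_W45 (Lc ++ Ln).toFinset hU hn₀ hn hlam'
    (fun s hs hgood => curv_floor_of_curvCheckL2 hL hcurv U hU hbox ξ₀ ξ hξ₀' hξ hn₀ hn hs hgood) hV' hG
  unfold Wrec at key
  linarith

/-! ## §2. The verdict with the centred slope constant -/

/-- The slope label set: the near labels of the box (centred ++ naive of the curvature leaf). -/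
def slL (c w : (Fin 3 × Fin 3) ⊕ Fin 3 → ℤ) : List (Fin 3 → ℤ) := cenL c w ++ naiL c w
/-- Labels centred by the slope leaf on the REFERENCE box (tube inside the bump / Lennard-Jones regime). -/
def slLc (c w : (Fin 3 × Fin 3) ⊕ Fin 3 → ℤ) : List (Fin 3 → ℤ) := (slL c w).filter fun b => slopeLabelOK c (refW w) b
/-- Labels kept naive by the slope leaf. -/
def slLn (c w : (Fin 3 × Fin 3) ⊕ Fin 3 → ℤ) : List (Fin 3 → ℤ) := (slL c w).filter fun b => !slopeLabelOK c (refW w) b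

/-- The computed centred slope constant of the box (reference box, slope split). -/
def slopeGsCC (c w : (Fin 3 × Fin 3) ⊕ Fin 3 → ℤ) : ℤ := slopeGsC c (refW w) (slLc c w) (slLn c w)

/-- ★ **THE ξ-CONVEXITY VERDICT WITH THE CENTRED SLOPE LEAF**: ball guard ∧ naive-slope guard (reference box) ∧ naive-curvature guard ∧ (computed
curvature floor `lamS > 0`) ∧ the table value leaf on the reference box at target `μ + cdiv(GsC², 2·lamS)`. -/
def entryLeafOKHCC (μ : ℤ) (c w : (Fin 3 × Fin 3) ⊕ Fin 3 → ℤ) : Bool :=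
  xiBallOK c w &&
  ((slLn c w).all fun b => (naiveK c (refW w) b).isSome) &&
  ((naiL c w).all fun b => (naiveK c w b).isSome) &&
  (match curvLamS c w (cenL c w) (naiL c w) with
    | none => false
    | some lamS => decide (0 < lamS) &&
        tableLeafOKHV qTableK1 tabE (μ + cdiv (slopeGsCC c w ^ 2) (2 * lamS)) c (refW w))

/-- ★★★ **SOUNDNESS OF `entryLeafOKHCC` IN THE hver SHAPE** (energy disjunct). [folklore chaining; skeleton of `entryLeafOKHC_sound`] -/
theorem entryLeafOKHCC_sound {μ : ℤ} {c w : (Fin 3 × Fin 3) ⊕ Fin 3 → ℤ} (h : entryLeafOKHCC μ c w = true) (U : E3 →L[ℝ] E3) (ξ : E3)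
    (_hsa : ∀ v v' : E3, ⟪U v, v'⟫ = ⟪v, U v'⟫) (hU : ‖U - 1‖ ≤ 1 / 4)
    (hbox : ∀ ab : Fin 3 × Fin 3, |(U (EuclideanSpace.single ab.2 (1 : ℝ))) ab.1 - (c (Sum.inl ab) : ℝ) / SC| ≤ (w (Sum.inl ab) : ℝ) / SC)
    (hξ : ∀ i : Fin 3, |ξ i - (c (Sum.inr i) : ℝ) / SC| ≤ (w (Sum.inr i) : ℝ) / SC) (_h0 : 0 ≤ ξ 0) (_h2 : 0 ≤ ξ 2) :
    (∀ (M : ℕ) (z : Fin M → E3) (cc : Fin M), Function.Injective z →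
        Set.range z = {x : E3 | dist x (z cc) ≤ 133 / 10 ∧ ∃ a : Fin 3 → ℤ,
          x = z cc + latPt U hexFrame a ∨ x = z cc + latPt U hexFrame a + U (hcpShift + ξ)} →
        TightNearCap (9 / 5) (3 / 2) z cc ∨ ExemptNear (9 / 5) ExRec z cc ∨ BadNearCap (9 / 5) (3 / 2) z cc) ∨
      (μ : ℝ) / SC ≤ ∑ b ∈ (Fintype.piFinset fun _ : Fin 3 => Finset.Icc (-7 : ℤ) 7).filter (fun b => b ≠ 0), effPot w₄₅ ω₄ (3 / 400) ‖latPt U hexFrame b‖ +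
        ∑ b ∈ (Fintype.piFinset fun _ : Fin 3 => Finset.Icc (-7 : ℤ) 7), effPot w₄₅ ω₄ (3 / 400) ‖latPt U hexFrame b + U (hcpShift + ξ)‖ := by
  classical
  refine Or.inr ?_
  have hS : (0 : ℝ) < SC := by norm_num [SC]
  unfold entryLeafOKHCC at h
  simp only [Bool.and_eq_true] at h
  obtain ⟨⟨⟨hball, hrefn⟩, hnai⟩, hm⟩ := h
  cases hls : curvLamS c w (cenL c w) (naiL c w) with
  | none => rw [hls] at hm; exact absurd hm (by simp)
  | some lamS =>
  rw [hls] at hm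
  simp only [Bool.and_eq_true, decide_eq_true_eq] at hm
  obtain ⟨hlam, htab⟩ := hm
  set L := cenL c w ++ naiL c w with hLdef
  set Gs := slopeGsCC c w with hGs
  set μ₀ := μ + cdiv (Gs ^ 2) (2 * lamS) with hμ₀
  -- the box has non-negative shuffle widths and lies in the ball
  have hw0 : ∀ i : Fin 3, (0 : ℝ) ≤ (w (Sum.inr i) : ℝ) / SC := fun i => (abs_nonneg _).trans (hξ i)
  have hξn : ‖ξ‖ ≤ 1 / 4 := norm_le_quarter_of_xiBallOK hball hξ
  have hξc : ∀ i : Fin 3, |cenShuf c i - (c (Sum.inr i) : ℝ) / SC| ≤ (w (Sum.inr i) : ℝ) / SC := fun i => by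
    rw [cenShuf_apply]; simpa using hw0 i
  have hξcn : ‖cenShuf c‖ ≤ 1 / 4 := norm_le_quarter_of_xiBallOK hball hξc
  -- labels
  have hLnd : L.Nodup := nodup_filter_append (nearLabels_nodup c w 2209 100) _
  have hLfin : L.toFinset = (nearLabels c w 2209 100).toFinset := toFinset_filter_append _ _
  have hLsnd : (slLc c w ++ slLn c w).Nodup := nodup_filter_append hLnd _
  have hLsfin : (slLc c w ++ slLn c w).toFinset = L.toFinset := toFinset_filter_append _ _
  have hcen : ((cenL c w).all fun b => labelOK2 c w b) = true := by
    rw [List.all_eq_true]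
    intro b hb
    have := (List.mem_filter.1 hb).2
    simp only [isCenL2, Bool.and_eq_true] at this
    exact this.1
  have hslc : ((slLc c w).all fun b => slopeLabelOK c (refW w) b) = true := by
    rw [List.all_eq_true]
    intro b hb
    exact (List.mem_filter.1 hb).2
  -- the three certificates
  have hslope : slopeCheckC c (refW w) (slLc c w) (slLn c w) Gs = true := slopeCheckC_slopeGsC hslc hrefn
  have hcurv : curvCheckL2 c w (cenL c w) (naiL c w) lamS = true := curvCheckL2_of_curvLamS hls hcen hnai
  -- the value floor at the centre shuffle, for every `U` of the box
  have hval : ∀ (U' : E3 →L[ℝ] E3) (ξ₀ : E3), ‖U' - 1‖ ≤ 1 / 4 →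
      (∀ ab : Fin 3 × Fin 3, |(U' (EuclideanSpace.single ab.2 (1 : ℝ))) ab.1 - (c (Sum.inl ab) : ℝ) / SC| ≤ ((refW w) (Sum.inl ab) : ℝ) / SC) →
      (∀ i : Fin 3, |ξ₀ i - (c (Sum.inr i) : ℝ) / SC| ≤ ((refW w) (Sum.inr i) : ℝ) / SC) → ‖ξ₀‖ ≤ 1 / 4 →
      (μ₀ : ℝ) / SC ≤ (∑ b ∈ (Fintype.piFinset fun _ : Fin 3 => Finset.Icc (-7 : ℤ) 7).filter (fun b => b ≠ 0), effPot w₄₅ ω₄ (3 / 400) ‖latPt U' hexFrame b‖) +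
        ∑ b ∈ L.toFinset, effPot w₄₅ ω₄ (3 / 400) ‖latPt U' hexFrame b + U' (hcpShift + ξ₀)‖ := by
    intro U' ξ₀ hU' hbox' hξ₀' _
    simp only [tableLeafOKHV, Bool.and_eq_true] at htab
    obtain ⟨hin, hleaf⟩ := htab
    obtain ⟨hV, hη⟩ := lvOf_mem U' ξ₀ hbox' hξ₀'
    have key := leafCheckV_sound_hcp (tabSem_of_allOKK qTableK1_allOKK) hleaf U' hU' ξ₀ (abs_le_of_shufInOK hin hξ₀') hV hη
    rw [sgnZ_two_natAbs] at key
    push_cast at key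
    have e : 2 * (μ₀ : ℝ) / SC / 2 = (μ₀ : ℝ) / SC := by ring
    rw [e] at key
    have hξ₀w : ∀ i : Fin 3, |ξ₀ i - (c (Sum.inr i) : ℝ) / SC| ≤ (w (Sum.inr i) : ℝ) / SC := fun i =>
      (hξ₀' i).trans (by simpa [refW] using hw0 i)
    have hbox'' : ∀ ab : Fin 3 × Fin 3, |(U' (EuclideanSpace.single ab.2 (1 : ℝ))) ab.1 - (c (Sum.inl ab) : ℝ) / SC| ≤ (w (Sum.inl ab) : ℝ) / SC :=
      fun ab => by simpa [refW] using hbox' ab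
    rw [boxSum_eq_nearSum (r2n := 2209) (r2d := 100) (by norm_num) (by norm_num) U' hbox'' ξ₀ hξ₀w, ← hLfin] at key
    exact key
  -- ξ-elimination on the box
  have hsame : ∀ ab : Fin 3 × Fin 3, c (Sum.inl ab) = c (Sum.inl ab) ∧ (refW w) (Sum.inl ab) = w (Sum.inl ab) := fun ab => ⟨rfl, rfl⟩
  have hsub : ∀ (i : Fin 3) (x : ℝ), |x - (c (Sum.inr i) : ℝ) / SC| ≤ ((refW w) (Sum.inr i) : ℝ) / SC → |x - (c (Sum.inr i) : ℝ) / SC| ≤ (w (Sum.inr i) : ℝ) / SC :=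
    fun i x hx => hx.trans (by simpa [refW] using hw0 i)
  have key := hcpEnergy_of_xiElimC hsame hsub hLnd hLsnd hLsfin hlam hslope hcurv
    (fun U' => ∑ b ∈ (Fintype.piFinset fun _ : Fin 3 => Finset.Icc (-7 : ℤ) 7).filter (fun b => b ≠ 0), effPot w₄₅ ω₄ (3 / 400) ‖latPt U' hexFrame b‖)
    hval U hU hbox (cenShuf c) (cenShuf_mem_ref c w) hξcn ξ hξ hξn
  rw [hLfin, ← boxSum_eq_nearSum (r2n := 2209) (r2d := 100) (by norm_num) (by norm_num) U hbox ξ hξ] at key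
  -- arithmetic: μ/SC ≤ μ₀/SC − (Gs/SC)²/(2·lamS/SC)
  have hlamR : (0 : ℝ) < lamS := by exact_mod_cast hlam
  have hcd := div_le_cdiv (a := Gs ^ 2) (b := 2 * lamS) (by positivity)
  push_cast at hcd
  have hμ : (μ : ℝ) / SC ≤ (μ₀ : ℝ) / SC - ((Gs : ℝ) / SC) ^ 2 / (2 * ((lamS : ℝ) / SC)) := by
    rw [hμ₀]
    push_cast
    have e : ((Gs : ℝ) / SC) ^ 2 / (2 * ((lamS : ℝ) / SC)) = ((Gs : ℝ) ^ 2 / (2 * lamS)) / SC := by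
      field_simp
    rw [e, ← sub_div, div_le_div_iff_of_pos_right hS]
    linarith
  exact hμ.trans key

/-! ## §3. The enlarged verdict and the hcp half -/

/-- ★ **hcp verdict with the centred-slope ξ-convexity leaf first**: `entryLeafOKHCC μ ∨ entryLeafOKHX μ`. -/
def entryLeafOKHCCX (μ : ℤ) (c w : (Fin 3 × Fin 3) ⊕ Fin 3 → ℤ) : Bool := entryLeafOKHCC μ c w || entryLeafOKHX μ c w

/-- ★★ Soundness of `entryLeafOKHCCX` in the hver shape. [folklore chaining] -/
theorem entryLeafOKHCCX_sound {μ : ℤ} {c w : (Fin 3 × Fin 3) ⊕ Fin 3 → ℤ} (h : entryLeafOKHCCX μ c w = true) (U : E3 →L[ℝ] E3) (ξ : E3)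
    (hsa : ∀ v v' : E3, ⟪U v, v'⟫ = ⟪v, U v'⟫) (hU : ‖U - 1‖ ≤ 1 / 4)
    (hbox : ∀ ab : Fin 3 × Fin 3, |(U (EuclideanSpace.single ab.2 (1 : ℝ))) ab.1 - (c (Sum.inl ab) : ℝ) / SC| ≤ (w (Sum.inl ab) : ℝ) / SC)
    (hξ : ∀ i : Fin 3, |ξ i - (c (Sum.inr i) : ℝ) / SC| ≤ (w (Sum.inr i) : ℝ) / SC) (h0 : 0 ≤ ξ 0) (h2 : 0 ≤ ξ 2) :
    (∀ (M : ℕ) (z : Fin M → E3) (cc : Fin M), Function.Injective z →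
        Set.range z = {x : E3 | dist x (z cc) ≤ 133 / 10 ∧ ∃ a : Fin 3 → ℤ,
          x = z cc + latPt U hexFrame a ∨ x = z cc + latPt U hexFrame a + U (hcpShift + ξ)} →
        TightNearCap (9 / 5) (3 / 2) z cc ∨ ExemptNear (9 / 5) ExRec z cc ∨ BadNearCap (9 / 5) (3 / 2) z cc) ∨
      (μ : ℝ) / SC ≤ ∑ b ∈ (Fintype.piFinset fun _ : Fin 3 => Finset.Icc (-7 : ℤ) 7).filter (fun b => b ≠ 0), effPot w₄₅ ω₄ (3 / 400) ‖latPt U hexFrame b‖ +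
        ∑ b ∈ (Fintype.piFinset fun _ : Fin 3 => Finset.Icc (-7 : ℤ) 7), effPot w₄₅ ω₄ (3 / 400) ‖latPt U hexFrame b + U (hcpShift + ξ)‖ := by
  simp only [entryLeafOKHCCX, Bool.or_eq_true] at h
  rcases h with h | h
  · exact entryLeafOKHCC_sound h U ξ hsa hU hbox hξ h0 h2
  · exact entryLeafOKHX_sound h U ξ hsa hU hbox hξ h0 h2

/-- ★★ The hcp half from ONE certificate tree over `entryLeafOKHCCX μ`. [folklore chaining: `…HomEntryFlipHcp.hcpHalf_of_entryTreeShuf`] -/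
theorem hcpHalf_of_entryTreeHCCX {m : ℝ} {μ : ℤ} (hμ : 2 * (m + (-(7175 / 10000) + 3 / 400)) * SC ≤ μ) {t : CertTree ((Fin 3 × Fin 3) ⊕ Fin 3)}
    (h : treeOK (entryLeafOKHCCX μ) t rootCH rootWH = true) :
    ∀ (U : E3 →L[ℝ] E3) (ξ : E3), (∀ v w : E3, inner ℝ (U v) w = inner ℝ v (U w)) → (∀ w : E3, 0 ≤ inner ℝ w (U w)) →
      ‖U - 1‖ ≤ 1 / 4 → ‖ξ‖ ≤ 1 / 4 → HcpDich m U ξ :=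
  hcpHalf_of_entryTreeShuf hμ (entryLeafOKHCCX μ) (fun _ _ hv U ξ hsa hU hbox hξ h0 h2 => entryLeafOKHCCX_sound hv U ξ hsa hU hbox hξ h0 h2) h

end Summit.AtomisticToContinuum.Crystallization.Theorems.FrustratedLawDichotomyStrainedPatchHomCurvLeafHCC

end
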